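import Literature.MathematicalPhysics.QuantumFieldTheory.Balaban1983to89.B9Thm37GlueTorusInv

/-!
# `Balaban1983to89.B9Thm37GlueTorusTwist` — a KERNEL-CHECKED BARRIER NOTE for the massless direction of the
# pv21 chain: with a FLAT ORTHOGONAL QUARTER-TURN transport on the circle, Δ_U + a·(U-independent componentwise
# mean / block mean) is SINGULAR (negative MODEL theorems; sibling leaf of `B9Thm37GlueTorusRW`; own lineage pv21;
# imports `B9Thm37GlueTorusInv` only; modifies nothing)

References (bib keys; the tags below cite only these):
* [B9] = `Balaban1985BackgroundPropagators` — T. Bałaban, *Propagators for lattice gauge theories in a background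
  field*, Commun. Math. Phys. 99 (1985) 389–434.

THE PRINTED LOCI.  Only loci already certified in the headers of modules in this file's import closure are referred
to, and only as CONTEXT: [B9] (3.3) pp. 390–391 (the covariant derivative in components, with the rotation R(U(b));
`B9Thm37Glue`), (3.8) p. 392 and (3.23) p. 394 (Δ_U = D\*D; `B9Thm37Glue`), (3.23)–(3.24) p. 394 (Δ′_a = Δ_U + Q′\*aQ′
with ⟨λ, Q′\*aQ′λ⟩ = Σ_j a_j Σ_{y∈Λ_j} (L^jη)^{d−2}|(Q′_j(U)λ)(y)|² — the printed averaging operators Q′_j(U) are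
functions of the configuration U; certified verbatim in the header of `B9Thm37Glue`), p. 395 (positivity of Δ′_a
"assuming some regularity of the configuration U"; `B9Thm37GlueTorusInv`), (3.42) p. 397 (the printed shape of the
decay bounds; `B9Thm37Glue`).  No statement of this file quotes print; every declaration below is a MODEL definition
or a kernel-checked theorem about the one-scale component model of the lineage, tagged [folklore].

THE POINT (value = a negative kernel certificate steering the lineage; NOT summit progress).  The pv21 chain
`B9Thm37GlueTorus → …E123 → …Inv → …RW → …Scaled` proves (3.42)-shaped decay for the inverse of the MASSIVE model
operator Δ_U + M_q (q ≥ q_min > 0; in `B9Thm37GlueTorusScaled`, q ≥ a₀η⁻²), where M_q is the lineage's one-scale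
diagonal stand-in for print's confining averaging term Q′\*aQ′ of (3.24); the honest remark there is that this regime
is the trivial one (decay on the scale of the lattice spacing) and that print's massless mechanism — confinement of
the constants by the AVERAGING term, not by a mass — is not modelled.  The obvious next stand-in one scale up is a
genuine averaging projector.  THIS FILE records, as theorems, why the CHEAPEST such stand-in is WRONG: if the
averaging is taken U-INDEPENDENT and componentwise («Q\*Q with the parallel transport dropped»: (T f)(x, i) = the mean
of the i-th component of f over the block of x), then Δ_U + a·T need not be invertible at all, for any coupling a and
any bond weight c, as soon as the transport has a flat twist commensurate with the blocks:
 * §2 (`not_isUnit_twist`, `inverse_twist_eq_zero`, `exists_orthogonal_singular`): on the 4-point circle (d = 1, N =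
   4, two components) with R(U(b)) = the quarter turn ((0, −1), (1, 0)) on every bond — ORTHOGONAL, so the lineage's
   binder `hRm` holds (`hRm_Rm4`), and FLAT (holonomy R⁴ = 1) — the field f(x) = (Rᵀ)^x e₁ (values (1,0), (0,−1),
   (−1,0), (0,1); `fw`) is non-zero, covariantly constant (∇_U f = `covD … f` = 0 for EVERY weight c, `covD_fw`) and
   has zero mean in each component (`sum_fw`); so f ∈ ker(Δ_U + a·Mean), the operator is not a unit, and `Ring.inverse
   (Δ_U + a·Mean) = 0` is Mathlib's junk value — every (3.42)-shaped statement about that «inverse» would be VACUOUS.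
 * §2b (`not_isUnit_twist8`, `inverse_twist8_eq_zero`): the same twist on the 8-point circle with TWO blocks of side
   M₀ = 4 kills the U-independent componentwise BLOCK mean (`blockMean`; block sums of the period-4 field vanish,
   `blockSum_fw8`), inside the standing torus regime of the chain (1 ≤ M₀, M₀ ∣ N, 2M₀ ≤ N: `lineage_hyps_N8`).
 * §1 isolates the mechanism (`not_isUnit_covLap_add_of_ker`: any lattice, transport, weight, and any operator T
   killing a non-zero covariantly constant field), §3 the CONTRAST (`isUnit_covLap_add_mulOp`, from
   `B9Thm37GlueTorusInv.posDef_covLap_add_mulOp`): the massive operator Δ_U + M_q, q > 0, is a unit for EVERY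
   transport — the massive chain has no twist obstruction, which is exactly why it cannot see this issue.

MORAL (informal beyond the kernel-checked instances; not a claim about print): a faithful massless stand-in must let
the averaging see the transport — as print's Q′_j(U) do by their very notation — e.g. a covariant block mean
(transport to a base point of the block before averaging), for which the covariantly constant fields are NOT killed
but reproduced; with a U-independent componentwise mean, a flat transport whose bond rotation R along one axis fixes
no non-zero vector and has finite order dividing the block side M₀ (so Σ_{k<M₀} R^k = 0 and the holonomy round the
torus is trivial when M₀ ∣ N; here R = the quarter turn, M₀ = 4) produces covariantly constant zero-block-mean fields
in every dimension (take the field (Rᵀ)^{x₁}e₁, constant in the other directions, and the transport trivial on the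
other bonds) — only the two smallest instances are formalised.  NOT continuum, NOT Clay, NOT a defect of print: a
constraint on OUR next model.
-/

namespace Literature.MathematicalPhysics.QuantumFieldTheory.Balaban1983to89.B9Thm37GlueTorusTwist

open Finset B9Thm37Sum B9Thm37Glue B9Thm37GluePU B9Thm37GlueTorusInv
open B5TorusCover (UT)
open B5Leibniz121 (up)

noncomputable section

/-! ## §1  The U-independent componentwise mean and a kernel criterion -/

section Mean

variable (X Cp : Type) [Fintype X]

/-- MODEL bookkeeping: the U-INDEPENDENT componentwise averaging projector over the whole (finite) lattice,
(Mean f)(x, i) = |X|⁻¹ Σ_y f(y, i) — the naive stand-in «block averaging with the parallel transport dropped» for a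
confining averaging term (one block = the whole lattice). [folklore] -/
def meanOp : Module.End ℝ (X × Cp → ℝ) where
  toFun f := fun p => (∑ y, f (y, p.2)) / Fintype.card X
  map_add' f f' := by
    funext p
    simp only [Pi.add_apply, Finset.sum_add_distrib, add_div]
  map_smul' r f := by
    funext p
    simp only [Pi.smul_apply, smul_eq_mul, RingHom.id_apply, ← Finset.mul_sum, mul_div_assoc]

/-- Unfolding of `meanOp`. [folklore] -/
@[simp] theorem meanOp_apply (f : X × Cp → ℝ) (p : X × Cp) :
    meanOp X Cp f p = (∑ y, f (y, p.2)) / Fintype.card X := rfl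

end Mean

/-- A linear operator on the functions on a finite set with a non-zero kernel vector is not a unit. [folklore] -/
theorem not_isUnit_of_apply_eq_zero {Y : Type} [Fintype Y] {A : Module.End ℝ (Y → ℝ)} {f : Y → ℝ}
    (hf : f ≠ 0) (h : A f = 0) : ¬ IsUnit A := by
  intro hu
  rw [LinearMap.isUnit_iff_ker_eq_bot, LinearMap.ker_eq_bot'] at hu
  exact hf (hu f h)

/-- THE MECHANISM (any lattice, any transport, any weight, any U-independent «averaging» T): a non-zero
covariantly constant field (∇_U f = 0) killed by T is in the kernel of Δ_U + a·T for every a, so that operator is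
not a unit and its `Ring.inverse` is the junk value 0. [folklore] -/
theorem not_isUnit_covLap_add_of_ker {St Bd Cp : Type} [Fintype St] [Fintype Bd] [Fintype Cp] [DecidableEq St]
    (src tgt : Bd → St) (c : Bd → ℝ) (Rm : Bd → Cp → Cp → ℝ) (T : Module.End ℝ (St × Cp → ℝ)) (a : ℝ)
    {f : St × Cp → ℝ} (hf : f ≠ 0) (hD : covD src tgt c Rm f = 0) (hT : T f = 0) :
    ¬ IsUnit (covDT src tgt c Rm ∘ₗ covD src tgt c Rm + a • T) := by
  refine not_isUnit_of_apply_eq_zero hf ?_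
  rw [LinearMap.add_apply, LinearMap.comp_apply, hD, map_zero, LinearMap.smul_apply, hT, smul_zero, add_zero]

/-! ## §2  The witness: the flat quarter-turn twist on the 4-point circle -/

section Witness

/-- MODEL: the periods of the 4-point circle (d = 1, N = 4). [folklore] -/
abbrev N4 : Fin 1 → ℕ := fun _ => 4

/-- The period 4 is non-zero. [folklore] -/
instance neZero_N4 (i : Fin 1) : NeZero (N4 i) := ⟨by simp [N4]⟩

/-- MODEL: the quarter-turn rotation matrix in components, R = ((0, −1), (1, 0)). [folklore] -/
def rot : Fin 2 → Fin 2 → ℝ := ![![0, -1], ![1, 0]]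

/-- MODEL: the flat transport on the circle — the same quarter turn on every bond (holonomy R⁴ = 1). [folklore] -/
def Rm4 : UT N4 × Fin 1 → Fin 2 → Fin 2 → ℝ := fun _ => rot

/-- The quarter turn is orthogonal: the binder `hRm` of the lineage holds for `Rm4`. [folklore] -/
theorem hRm_Rm4 : ∀ (b : UT N4 × Fin 1) (i j : Fin 2),
    ∑ k, Rm4 b k i * Rm4 b k j = if i = j then (1 : ℝ) else 0 := by
  intro b i j
  fin_cases i <;> fin_cases j <;> simp [Rm4, rot, Fin.sum_univ_two]

/-- MODEL: the values of the covariantly constant field along the circle, f(k) = (Rᵀ)^k e₁: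
(1, 0), (0, −1), (−1, 0), (0, 1). [folklore] -/
def gtab : Fin 4 → Fin 2 → ℝ := ![![1, 0], ![0, -1], ![-1, 0], ![0, 1]]

/-- MODEL: the witness field on the circle with two components. [folklore] -/
def fw : UT N4 × Fin 2 → ℝ := fun p => gtab (UT.toSite N4 p.1 0) p.2

/-- The transport relation R·f(k+1) = f(k) along the circle. [folklore] -/
theorem rot_gtab (k : Fin 4) (i : Fin 2) : ∑ j, rot i j * gtab (k + 1) j = gtab k i := by
  fin_cases k <;> fin_cases i <;> simp [rot, gtab, Fin.sum_univ_two]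

/-- The field values sum to zero in each component (the four fourth roots of unity). [folklore] -/
theorem sum_gtab (i : Fin 2) : ∑ k, gtab k i = 0 := by
  fin_cases i <;> simp [gtab, Fin.sum_univ_four]

/-- The witness field is not zero. [folklore] -/
theorem fw_ne_zero : fw ≠ 0 := by
  intro h
  have h0 := congrFun h (UT.ofSite N4 (fun _ => 0), 0)
  simp [fw, gtab] at h0

/-- The forward neighbour on the circle advances the coordinate by one. [folklore] -/
theorem toSite_up_zero (x : UT N4) : UT.toSite N4 (up x 0) 0 = UT.toSite N4 x 0 + 1 := by
  simp [up]

/-- **The witness field is covariantly constant**: ∇_U f = 0 for EVERY bond weight c. [folklore] -/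
theorem covD_fw (c : UT N4 × Fin 1 → ℝ) : covD bsrc btgt c Rm4 fw = 0 := by
  funext q
  obtain ⟨⟨x, μ⟩, i⟩ := q
  have hμ : μ = 0 := Subsingleton.elim _ _
  subst hμ
  simp only [covD_apply, Pi.zero_apply, bsrc_apply, btgt_apply, Rm4, fw, toSite_up_zero]
  rw [mul_eq_zero, sub_eq_zero]
  exact Or.inr (rot_gtab _ _)

/-- The 4-point circle carrier is `Fin 4` (read the single coordinate). [folklore] -/
def eqv : UT N4 ≃ Fin 4 where
  toFun x := UT.toSite N4 x 0
  invFun k := UT.ofSite N4 (fun _ => k)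
  left_inv x := by
    funext j
    have hj : j = 0 := Subsingleton.elim _ _
    subst hj
    rfl
  right_inv k := rfl

/-- **The witness field has zero componentwise mean.** [folklore] -/
theorem sum_fw (i : Fin 2) : ∑ x : UT N4, fw (x, i) = 0 := by
  rw [Fintype.sum_equiv eqv (fun x => fw (x, i)) (fun k => gtab k i) (fun x => rfl)]
  exact sum_gtab i

/-- `Mean f = 0` for the witness. [folklore] -/
theorem meanOp_fw : meanOp (UT N4) (Fin 2) fw = 0 := by
  funext p
  rw [meanOp_apply, sum_fw, zero_div, Pi.zero_apply]

/-- **KERNEL-CHECKED BARRIER NOTE (negative; MODEL).** On the 4-point circle with the flat orthogonal quarter-turn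
transport, Δ_U + a·Mean is NOT invertible, for every bond weight c and every coupling a: the U-independent
componentwise mean does not confine the covariantly constant zero-mean field `fw`. [folklore] -/
theorem not_isUnit_twist (c : UT N4 × Fin 1 → ℝ) (a : ℝ) :
    ¬ IsUnit (covDT bsrc btgt c Rm4 ∘ₗ covD bsrc btgt c Rm4 + a • meanOp (UT N4) (Fin 2)) :=
  not_isUnit_covLap_add_of_ker bsrc btgt c Rm4 _ a fw_ne_zero (covD_fw c) meanOp_fw

/-- Hence `Ring.inverse (Δ_U + a·Mean)` is the JUNK value 0 for the twist: any (3.42)-shaped statement about this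
«inverse» would be vacuous. [folklore] -/
theorem inverse_twist_eq_zero (c : UT N4 × Fin 1 → ℝ) (a : ℝ) :
    Ring.inverse (covDT bsrc btgt c Rm4 ∘ₗ covD bsrc btgt c Rm4 + a • meanOp (UT N4) (Fin 2)) = 0 :=
  Ring.inverse_non_unit _ (not_isUnit_twist c a)

/-- The same twist in existential form over the lineage's binders: an ORTHOGONAL transport (`hRm`) on a torus of the
lineage for which Δ_U + a·Mean is singular for all c, a. [folklore] -/
theorem exists_orthogonal_singular :
    ∃ (Rm : UT N4 × Fin 1 → Fin 2 → Fin 2 → ℝ),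
      (∀ b i j, ∑ k, Rm b k i * Rm b k j = if i = j then (1 : ℝ) else 0) ∧
      ∀ (c : UT N4 × Fin 1 → ℝ) (a : ℝ),
        ¬ IsUnit (covDT bsrc btgt c Rm ∘ₗ covD bsrc btgt c Rm + a • meanOp (UT N4) (Fin 2)) :=
  ⟨Rm4, hRm_Rm4, not_isUnit_twist⟩

end Witness

/-! ## §2b  Two blocks: the same twist kills the U-independent BLOCK mean (M₀ = 4, N = 8) -/

section TwoBlocks

/-- MODEL: the periods of the 8-point circle (d = 1, N = 8), carrying two blocks of side M₀ = 4. [folklore] -/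
abbrev N8 : Fin 1 → ℕ := fun _ => 8

/-- The period 8 is non-zero. [folklore] -/
instance neZero_N8 (i : Fin 1) : NeZero (N8 i) := ⟨by simp [N8]⟩

/-- The lineage's standing torus hypotheses `hM : 1 ≤ M₀`, `hdiv : M₀ ∣ N i`, `h2N : 2M₀ ≤ N i` hold for M₀ = 4 on
the 8-point circle — the witness lives inside the regime of the pv21 chain. [folklore] -/
theorem lineage_hyps_N8 : (1 : ℕ) ≤ 4 ∧ (∀ i, 4 ∣ N8 i) ∧ ∀ i, 2 * 4 ≤ N8 i :=
  ⟨by norm_num, fun _ => ⟨2, rfl⟩, fun _ => le_rfl⟩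

/-- MODEL: the flat quarter-turn transport on the 8-point circle (holonomy R⁸ = 1). [folklore] -/
def Rm8 : UT N8 × Fin 1 → Fin 2 → Fin 2 → ℝ := fun _ => rot

/-- `hRm` holds for `Rm8`. [folklore] -/
theorem hRm_Rm8 : ∀ (b : UT N8 × Fin 1) (i j : Fin 2),
    ∑ k, Rm8 b k i * Rm8 b k j = if i = j then (1 : ℝ) else 0 := by
  intro b i j
  fin_cases i <;> fin_cases j <;> simp [Rm8, rot, Fin.sum_univ_two]

/-- MODEL: the covariantly constant field along the 8-point circle, f(k) = (Rᵀ)^k e₁ (period 4). [folklore] -/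
def gtab8 : Fin 8 → Fin 2 → ℝ := ![![1, 0], ![0, -1], ![-1, 0], ![0, 1], ![1, 0], ![0, -1], ![-1, 0], ![0, 1]]

/-- MODEL: the witness field on the 8-point circle. [folklore] -/
def fw8 : UT N8 × Fin 2 → ℝ := fun p => gtab8 (UT.toSite N8 p.1 0) p.2

/-- The transport relation R·f(k+1) = f(k) along the 8-point circle. [folklore] -/
theorem rot_gtab8 (k : Fin 8) (i : Fin 2) : ∑ j, rot i j * gtab8 (k + 1) j = gtab8 k i := by
  fin_cases k <;> fin_cases i <;> simp [rot, gtab8, Fin.sum_univ_two]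

/-- MODEL: the block label of a site, blocks {0,1,2,3} and {4,5,6,7} (side M₀ = 4). [folklore] -/
def blkOf : Fin 8 → Fin 2 := ![0, 0, 0, 0, 1, 1, 1, 1]

/-- MODEL bookkeeping: the U-INDEPENDENT componentwise BLOCK mean, (T f)(x, i) = M₀⁻¹ Σ_{y ∈ B(x)} f(y, i) —
«Q*Q with the parallel transport dropped» for the two blocks of side 4. [folklore] -/
def blockMean : Module.End ℝ (UT N8 × Fin 2 → ℝ) where
  toFun f := fun p =>
    (∑ y, (if blkOf (UT.toSite N8 y 0) = blkOf (UT.toSite N8 p.1 0) then (1 : ℝ) else 0) * f (y, p.2)) / 4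
  map_add' f f' := by
    funext p
    simp only [Pi.add_apply, mul_add, Finset.sum_add_distrib, add_div]
  map_smul' r f := by
    funext p
    simp only [Pi.smul_apply, smul_eq_mul, RingHom.id_apply]
    rw [← mul_div_assoc, Finset.mul_sum]
    exact congrArg (fun t => t / 4) (Finset.sum_congr rfl fun y _ => by ring)

/-- The 8-point circle carrier is `Fin 8`. [folklore] -/
def eqv8 : UT N8 ≃ Fin 8 where
  toFun x := UT.toSite N8 x 0
  invFun k := UT.ofSite N8 (fun _ => k)
  left_inv x := by
    funext j
    have hj : j = 0 := Subsingleton.elim _ _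
    subst hj
    rfl
  right_inv k := rfl

/-- **Every block sum of the witness vanishes in each component** (a window of length 4 of the period-4 field).
[folklore] -/
theorem blockSum_fw8 (β i : Fin 2) :
    ∑ y : UT N8, (if blkOf (UT.toSite N8 y 0) = β then (1 : ℝ) else 0) * fw8 (y, i) = 0 := by
  rw [Fintype.sum_equiv eqv8 (fun y => (if blkOf (UT.toSite N8 y 0) = β then (1 : ℝ) else 0) * fw8 (y, i))
    (fun k => (if blkOf k = β then (1 : ℝ) else 0) * gtab8 k i) (fun x => rfl)]
  fin_cases β <;> fin_cases i <;> simp [Fin.sum_univ_eight, blkOf, gtab8]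

/-- `blockMean fw8 = 0`. [folklore] -/
theorem blockMean_fw8 : blockMean fw8 = 0 := by
  funext p
  show (∑ y, (if blkOf (UT.toSite N8 y 0) = blkOf (UT.toSite N8 p.1 0) then (1 : ℝ) else 0) * fw8 (y, p.2)) / 4
    = 0
  rw [blockSum_fw8, zero_div]

/-- The witness field is not zero. [folklore] -/
theorem fw8_ne_zero : fw8 ≠ 0 := by
  intro h
  have h0 := congrFun h (UT.ofSite N8 (fun _ => 0), 0)
  simp [fw8, gtab8] at h0

/-- The forward neighbour on the 8-point circle advances the coordinate by one. [folklore] -/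
theorem toSite_up_zero8 (x : UT N8) : UT.toSite N8 (up x 0) 0 = UT.toSite N8 x 0 + 1 := by
  simp [up]

/-- **The witness field is covariantly constant on the 8-point circle**, for every bond weight. [folklore] -/
theorem covD_fw8 (c : UT N8 × Fin 1 → ℝ) : covD bsrc btgt c Rm8 fw8 = 0 := by
  funext q
  obtain ⟨⟨x, μ⟩, i⟩ := q
  have hμ : μ = 0 := Subsingleton.elim _ _
  subst hμ
  simp only [covD_apply, Pi.zero_apply, bsrc_apply, btgt_apply, Rm8, fw8, toSite_up_zero8]
  rw [mul_eq_zero, sub_eq_zero]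
  exact Or.inr (rot_gtab8 _ _)

/-- **KERNEL-CHECKED BARRIER NOTE, block form (negative; MODEL).** On the 8-point circle (M₀ = 4 ∣ N = 8,
2M₀ ≤ N) with the flat orthogonal quarter-turn transport, Δ_U + a·T is NOT invertible for the U-independent block
mean T, every bond weight c and every coupling a. [folklore] -/
theorem not_isUnit_twist8 (c : UT N8 × Fin 1 → ℝ) (a : ℝ) :
    ¬ IsUnit (covDT bsrc btgt c Rm8 ∘ₗ covD bsrc btgt c Rm8 + a • blockMean) :=
  not_isUnit_covLap_add_of_ker bsrc btgt c Rm8 _ a fw8_ne_zero (covD_fw8 c) blockMean_fw8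

/-- Hence `Ring.inverse (Δ_U + a·T) = 0` (junk) for the block twist. [folklore] -/
theorem inverse_twist8_eq_zero (c : UT N8 × Fin 1 → ℝ) (a : ℝ) :
    Ring.inverse (covDT bsrc btgt c Rm8 ∘ₗ covD bsrc btgt c Rm8 + a • blockMean) = 0 :=
  Ring.inverse_non_unit _ (not_isUnit_twist8 c a)

end TwoBlocks

/-! ## §3  Contrast: the massive term always confines -/

/-- CONTRAST (restated from `B9Thm37GlueTorusInv` by name): with a strictly positive site weight q the operator
Δ_U + M_q IS a unit, for every lattice, transport and weight — the massive regime of the pv21 chain has no such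
twist obstruction. [folklore] -/
theorem isUnit_covLap_add_mulOp {St Bd Cp : Type} [Fintype St] [Fintype Bd] [Fintype Cp] [DecidableEq St]
    [DecidableEq Cp] (src tgt : Bd → St) (c : Bd → ℝ) (Rm : Bd → Cp → Cp → ℝ) {q : St × Cp → ℝ}
    (hq : ∀ p, 0 < q p) : IsUnit (covDT src tgt c Rm ∘ₗ covD src tgt c Rm + mulOp q) :=
  isUnit_of_posDef (posDef_covLap_add_mulOp src tgt c Rm hq)

end

end Literature.MathematicalPhysics.QuantumFieldTheory.Balaban1983to89.B9Thm37GlueTorusTwist
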